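import Summits.CriticalPhenomena.PercolationContinuityZ3.Theorems.PercNearOneGluingNoHeavyLowerTailQ44bGluingAC
import HarnessLib

/-!
# `Q44b` is concave along the pencil of every pair into the sure cluster of `c` (the `z ∈ [c]` case of `ND_a`)

Support file for crux `stmt-CriticalPhenomena-4575` (master-family programme, quadratic four-point row `Q44b` of
`prim-bnk-1` gen 13, OPEN for all `n`), seat `prim-l12-p6` gen 12; memo
`run/shared/lean/prim/prim-l12/FROM-prim-l12-p6-g12-K8-CENSUS.md` §7.

Gen 7 proved the four-point inequality `Q44bExchange.pencilAtC` ("`Q44b` is concave along the `{a,c}` pencil") but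
not its link to the pencil hypothesis `Q44b.PencilConcave w s(x,z)` of the reductions `Q44b.row_nonneg_of_pencilConcave`
/ `Q44b.row_nonneg_of_mixedAt`.  With the gluing identity `P_{w[e↦1]}(E) = P_w({ω : ω ∪ {e} ∈ E})` and the pointwise
description of the glued cells (`…Q44bGluingAC.lean`) this file supplies the link:

* `Q44b.bil_le_mixed_of_sureJoined_ac` — `B₀ ≤ B₀₁ + B₁₀` along `s(x,z)` when `x ∈ [a]`, `z ∈ [c]` surely under `w₀`
  (the difference `B₀₁ + B₁₀ − B₀` is literally RHS − LHS of `pencilAtC` at `w₀`);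
* `Q44b.pencilConcave_of_sureJoined_c`, `Q44b.pencilMixed_of_sureJoined_c` — `ND_a` / the mixed-coefficient
  hypothesis at every pair running into `c`'s sure cluster (`B₂ = 0` there).
Together with `…Q44bPencilAtB.lean` (pairs into `b`'s cluster) and the `c ↔ y` symmetry of the row, the residual
hypothesis of both reductions is the pencil of pairs `s(x,z)` with `z` outside the sure clusters of the terminals.
Theorems only; no named facts, no sorries, standard axioms.
-/

noncomputable section

namespace Summit.CriticalPhenomena.PercolationContinuityZ3.Theorems

namespace Q44b

open MeasureTheory Set Literature.Probability.LatticeModels Literature.Probability.Percolation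
open scoped Classical

variable {n : ℕ}

/-- **Gluing step at `c`.**  If `x ∈ [a]` and `z ∈ [c]` surely under `w₀` (`x ≠ z`), then with `w₁ = w₀[s(x,z)↦1]`:
`bil w₀ w₀ ≤ bil w₀ w₁ + bil w₁ w₀`, the slack being RHS − LHS of `Q44bExchange.pencilAtC` at `w₀`. [this work] -/
theorem bil_le_mixed_of_sureJoined_ac (w0 : Sym2 (Fin n) → unitInterval) {a c x z : Fin n} (b y : Fin n)
    (hxz : x ≠ z) (hx : sureJoined w0 a x) (hz : sureJoined w0 c z) :
    bil w0 w0 a b c y ≤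
      bil w0 (Function.update w0 s(x, z) 1) a b c y + bil (Function.update w0 s(x, z) 1) w0 a b c y := by
  -- `a ~ c` almost surely in the glued copy
  have hac1 : (prodBernoulli (Function.update w0 s(x, z) 1)).real (openConn a c) = 1 := by
    have h1 : sureJoined (Function.update w0 s(x, z) 1) a x := sureJoined_update_one w0 _ hx
    have h2 : sureJoined (Function.update w0 s(x, z) 1) c z := sureJoined_update_one w0 _ hz
    have h3 : sureJoined (Function.update w0 s(x, z) 1) x z := by
      apply SimpleGraph.Adj.reachable
      rw [SimpleGraph.fromEdgeSet_adj]
      exact ⟨by simp, hxz⟩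
    unfold sureJoined at h1 h2 h3
    exact real_openConn_eq_one_of_sureJoined _ a c ((h1.trans h3).trans h2.symm)
  have cac : (prodBernoulli (Function.update w0 s(x, z) 1)).real (openConn a c)ᶜ = 0 := by
    rw [real_compl, hac1]; ring
  have zAD : (prodBernoulli (Function.update w0 s(x, z) 1)).real (evAD a b c y) = 0 :=
    real_eq_zero_of_subset _ (fun ω hω => hω.1.2) cac
  have zAB : (prodBernoulli (Function.update w0 s(x, z) 1)).real (evAB a b c y) = 0 :=
    real_eq_zero_of_subset _ (fun ω hω => hω.1.1.2) cac
  have zPend : (prodBernoulli (Function.update w0 s(x, z) 1)).real (evPend a b c y) = 0 :=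
    real_eq_zero_of_subset _ (fun ω hω => hω.1.1.1.2) cac
  have zEmp : (prodBernoulli (Function.update w0 s(x, z) 1)).real (evEmp a b c y) = 0 :=
    real_eq_zero_of_subset _ (fun ω hω => hω.1.1.1.1.2) cac
  -- gluing identity
  have glue : ∀ E : Set (BondConfig (Fin n)),
      (prodBernoulli (Function.update w0 s(x, z) 1)).real E = (prodBernoulli w0).real {ω | insert s(x, z) ω ∈ E} := by
    intro E
    have hE : DeterminedBy E (↑(Finset.univ : Finset (Sym2 (Fin n))) : Set (Sym2 (Fin n))) :=
      TargetExploration.determinedBy_univ E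
    exact prodBernoulli_real_update_one_eq hE w0 (Finset.mem_univ _)
  have hae : ∀ᵐ ω ∂(prodBernoulli w0), (openGraph ω).Reachable a x ∧ (openGraph ω).Reachable c z := by
    filter_upwards [ae_reachable_of_sureJoined w0 a x hx, ae_reachable_of_sureJoined w0 c z hz] with ω h1 h2
    exact ⟨h1, h2⟩
  -- glued events, cut into cells
  have gAC : (prodBernoulli (Function.update w0 s(x, z) 1)).real (evAC a b c y) =
      (prodBernoulli w0).real (evAC a b c y) +
        (prodBernoulli w0).real
          ((openConn a c)ᶜ ∩ (openConn b c)ᶜ ∩ (openConn y c)ᶜ ∩ (openConn a b ∩ openConn a y)) +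
        (prodBernoulli w0).real ((openConn a b)ᶜ ∩ (openConn a c)ᶜ ∩ openConn a y ∩ openConn b c) +
        (prodBernoulli w0).real (evPend a b c y) := by
    rw [glue, ← measureReal_union (disjoint_AC_abyc a b c y) MeasurableSet.of_discrete,
      ← measureReal_union (disjoint_ACabyc_aybc a b c y) MeasurableSet.of_discrete,
      ← measureReal_union (disjoint_ACabycaybc_Pend a b c y) MeasurableSet.of_discrete, ← glueAC_union_eq]
    refine measureReal_congr ?_
    filter_upwards [hae] with ω hω
    exact propext (insert_mem_evAC_iff_c ω hω.1 hω.2)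
  have gX : (prodBernoulli (Function.update w0 s(x, z) 1)).real (evX a b c y) =
      (prodBernoulli w0).real ((openConn a b)ᶜ ∩ (openConn a y)ᶜ ∩ openConn a c ∩ openConn b y) +
        (prodBernoulli w0).real
          ((openConn a b)ᶜ ∩ (openConn a c)ᶜ ∩ (openConn a y)ᶜ ∩ openConn b y ∩ (openConn c y)ᶜ) := by
    rw [glue, ← measureReal_union (disjoint_acby_abyc a b c y) MeasurableSet.of_discrete, ← glueX_eq]
    refine measureReal_congr ?_
    filter_upwards [hae] with ω hω
    exact propext (insert_mem_evX_iff_c ω hω.1 hω.2)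
  have gCnA : (prodBernoulli (Function.update w0 s(x, z) 1)).real (evCnA a b c y) =
      (prodBernoulli w0).real (openConn c y ∩ (openConn a b)ᶜ ∩ (openConn c b)ᶜ) +
        (prodBernoulli w0).real
          ((openConn a c)ᶜ ∩ (openConn b c)ᶜ ∩ (openConn y c)ᶜ ∩ ((openConn a b)ᶜ ∩ openConn a y)) := by
    rw [glue, ← measureReal_union (disjoint_glueCnA a b c y) MeasurableSet.of_discrete, ← glueCnA_eq]
    refine measureReal_congr ?_
    filter_upwards [hae] with ω hω
    exact propext (insert_mem_evCnA_iff_c ω hω.1 hω.2)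
  have gXp : (prodBernoulli (Function.update w0 s(x, z) 1)).real (evXp a b c y) =
      (prodBernoulli w0).real (evEmp a b c y) +
        (prodBernoulli w0).real ((openConn a b)ᶜ ∩ (openConn a y)ᶜ ∩ openConn a c ∩ (openConn b y)ᶜ) := by
    rw [glue, ← measureReal_union (disjoint_glueXp a b c y) MeasurableSet.of_discrete, ← glueXp_eq]
    refine measureReal_congr ?_
    filter_upwards [hae] with ω hω
    exact propext (insert_mem_evXp_iff_c ω hω.1 hω.2)
  -- cells under `w0`
  have dX : (prodBernoulli w0).real (evX a b c y) =
      (prodBernoulli w0).real ((openConn a b)ᶜ ∩ (openConn a y)ᶜ ∩ openConn a c ∩ openConn b y) +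
        (prodBernoulli w0).real ((openConn a b)ᶜ ∩ (openConn a c)ᶜ ∩ openConn a y ∩ openConn b c) := by
    rw [← measureReal_union (disjoint_X12 a b c y) MeasurableSet.of_discrete, ← evX_eq]
  have dCnA : (prodBernoulli w0).real (evCnA a b c y) =
      (prodBernoulli w0).real (openConn c y ∩ (openConn a b)ᶜ ∩ (openConn c b)ᶜ) +
        (prodBernoulli w0).real (evPend a b c y) := by
    rw [← measureReal_union (disjoint_evCnA_c a b c y) MeasurableSet.of_discrete, ← evCnA_eq_c]
  have dXp : (prodBernoulli w0).real (evXp a b c y) =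
      (prodBernoulli w0).real ((openConn a b)ᶜ ∩ (openConn a y)ᶜ ∩ openConn a c ∩ (openConn b y)ᶜ) +
        (prodBernoulli w0).real ((openConn a b)ᶜ ∩ (openConn a c)ᶜ ∩ openConn a y ∩ (openConn b c)ᶜ) := by
    rw [← measureReal_union (disjoint_Xp12 a b c y) MeasurableSet.of_discrete, ← evXp_eq]
  have dXp2 : (prodBernoulli w0).real ((openConn a b)ᶜ ∩ (openConn a c)ᶜ ∩ openConn a y ∩ (openConn b c)ᶜ) =
      (prodBernoulli w0).real
        ((openConn a c)ᶜ ∩ (openConn b c)ᶜ ∩ (openConn y c)ᶜ ∩ ((openConn a b)ᶜ ∩ openConn a y)) := by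
    rw [cell_ay_b_c_eq]
  have dEmp : (prodBernoulli w0).real (evEmp a b c y) =
      (prodBernoulli w0).real
        ((openConn a c)ᶜ ∩ (openConn b c)ᶜ ∩ (openConn y c)ᶜ ∩
          ((openConn a b)ᶜ ∩ (openConn a y)ᶜ ∩ (openConn b y)ᶜ)) := by
    rw [evEmp_eq_c]
  have dAD : (prodBernoulli w0).real (evAD a b c y) =
      (prodBernoulli w0).real ((openConn a c)ᶜ ∩ (openConn a y)ᶜ ∩ (openConn a b ∩ openConn c y)) +
        (prodBernoulli w0).real ((openConn a c)ᶜ ∩ (openConn a y)ᶜ ∩ openConn a b ∩ (openConn c y)ᶜ) := by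
    rw [← measureReal_union (disjoint_evAD_c a b c y) MeasurableSet.of_discrete, ← evAD_eq_c]
  have dAB : (prodBernoulli w0).real (evAB a b c y) =
      (prodBernoulli w0).real ((openConn a c)ᶜ ∩ (openConn a y)ᶜ ∩ openConn a b ∩ (openConn c y)ᶜ) := by
    rw [evAB_eq_c]
  have dPend : (prodBernoulli w0).real (evPend a b c y) =
      (prodBernoulli w0).real
        ((openConn a b)ᶜ ∩ (openConn a c)ᶜ ∩ (openConn a y)ᶜ ∩ (openConn b y ∩ openConn c y)) := by
    rw [evPend_eq_c]
  -- the four-point inequality (ND_a at c)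
  have key := Q44bExchange.pencilAtC w0 a b c y
  unfold bil
  rw [zEmp, gX, gCnA, gXp, gAC, zAD, zAB, zPend, dX, dCnA, dXp, dXp2, dEmp, dAD, dAB, dPend]
  linear_combination key

/-- **`ND_a` at the pairs into `c`'s sure cluster.**  If `x` is surely joined to `a` and `z` to `c` in `w[s(x,z)↦0]`
(`x ≠ z`), the row `Q44b` is concave along the pencil of `s(x,z)` (`B₂ = 0`, `B₀ ≤ B₀₁ + B₁₀`). [this work] -/
theorem pencilConcave_of_sureJoined_c (w : Sym2 (Fin n) → unitInterval) {a c x z : Fin n} (b y : Fin n)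
    (hxz : x ≠ z) (hx : sureJoined (Function.update w s(x, z) 0) a x)
    (hz : sureJoined (Function.update w s(x, z) 0) c z) :
    PencilConcave w s(x, z) a b c y := by
  unfold PencilConcave
  have hac1 : (prodBernoulli (Function.update w s(x, z) 1)).real (openConn a c) = 1 :=
    real_openConn_eq_one_of_sureJoined _ a c (sureJoined_ab_of_pair w hxz hx hz)
  rw [bil_eq_zero_of_conn_one _ _ a b c y c (Or.inr (Or.inl rfl)) hac1 hac1, add_zero]
  have h := bil_le_mixed_of_sureJoined_ac (Function.update w s(x, z) 0) b y hxz hx hz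
  rwa [Function.update_idem] at h

/-- Hence the mixed Bernstein coefficient of that pencil is (conditionally) nonnegative
(`Q44b.PencilMixed`, the hypothesis shape of `Q44b.row_nonneg_of_mixedAt`). [this work] -/
theorem pencilMixed_of_sureJoined_c (w : Sym2 (Fin n) → unitInterval) {a c x z : Fin n} (b y : Fin n)
    (hxz : x ≠ z) (hx : sureJoined (Function.update w s(x, z) 0) a x)
    (hz : sureJoined (Function.update w s(x, z) 0) c z) :
    PencilMixed w s(x, z) a b c y :=
  pencilMixed_of_pencilConcave w s(x, z) a b c y (pencilConcave_of_sureJoined_c w b y hxz hx hz)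

end Q44b

end Summit.CriticalPhenomena.PercolationContinuityZ3.Theorems

end
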